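import Summits.CriticalPhenomena.PercolationContinuityZ3.Theorems.SahiMasterFamilyPCDSupportFlag
import Summits.CriticalPhenomena.PercolationContinuityZ3.Theorems.SahiMasterFamilyTopCoeffAll
import Literature.Combinatorics.Sahi2008.PushForward

/-!
# The principal-cap dichotomy, VII: BRIDGE to the master-family vocabulary — (EQI-k) on the principal-cap class, every `k`

Support file of the master-family programme (crux `NoHeavyLowerTail`, stmt-CriticalPhenomena-4575; cell `prim-masterthm`, seat P4,
unit `prim-masterthm-p4-g6`).  Seat document HOME/prim-masterthm-p4/P4-GEN6-REPORT.md.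

The sparse-end / PCD files speak of events as `Finset (Finset ι)` under the signed product weight `spw w p`; the master-family statements
(`SahiMasterFamily.lean`, `SahiMasterFamilyHeredity.lean`: `MasterFamilyIdentEqIff k`, the zero-flag class `SuppZeroFlag k`) speak of
`Set (Set ι)` under `bernoulliWeight p`, `p` in the open cube.  This file transports `finSuppZeroFlag_of_forall_sahiE_eq_zero` across:

* `toFinsetFam U j = {s : ↑s ∈ U_j}`; `weight x ↑s = spw x 1 s`; **`sahiE_spw_toFinsetFam`**: `E_k(spw x 1; 1_{toFinsetFam U}) = E_k(weight x; 1_U)`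
  (push-forward along `Finset ι ≃ Set ι`, tree `sahiE_pushWeight`);
* `forall_sahiE_weight_eq_zero_of_interior` — if `E_k(μ_p; 1_U) = 0` for every INTERIOR `p` then `E_k(weight x; 1_U) = 0` for EVERY real `x`
  (tree `sahiEPoly`, `degreeOf_sahiEPoly_le`, Alon's Nullstellensatz on an interior grid `eq_zero_of_eval_zero_at_prod_finset`);
* `suppZeroFlag_of_finSuppZeroFlag` — the `Finset` support flag of `toFinsetFam U` is the tree's `SuppZeroFlag` of `U`;
* **`suppZeroFlag_of_principalCap`** — for every `n`, every finite `ι`, every family of `n + 1` increasing events `U_j ⊆ 2^ι` that are not sure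
  (`∅ ∉ U_j`) and PRINCIPAL-CAP (`⋂ U_j = {S : c ⊆ S}` for a finset `c`): if `E_{n+1}(μ_p; 1_U) = 0` for every interior `p`, then `U ∈ Z_{n+1}`;
  with the tree's `sahiE_ind_eq_zero_of_suppZeroFlag`: **`sahiE_eq_zero_iff_suppZeroFlag_of_principalCap`** — `MasterFamilyIdentEqIff (n+1)`
  RESTRICTED TO THE PRINCIPAL-CAP CLASS holds, for every `n` (the class contains every tight family: all coordinates mandatory somewhere).
HONEST FRAMING: identically-zero form on a sub-class; the pointwise `MasterFamilyEqIff`, Sahi `C_k` [Sahi2008, Conj. 5] and Kahn's Conj. 5 remain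
OPEN.  [this work]
-/

noncomputable section

open scoped Classical

namespace Summit.CriticalPhenomena.PercolationContinuityZ3.Theorems

namespace SahiSparseEnd

open Finset Function MvPolynomial
open Literature.Combinatorics.Sahi2008
open Literature.Probability.Percolation (DeterminedBy determinedBy_iff)
open Literature.Probability.Percolation.BHK2006 (weight)
open Literature.Probability.Percolation.DecisionTree (ind ind_of_mem ind_of_not_mem)

universe u

variable {ι : Type u} [Fintype ι]

/-! ### From `Set` families to `Finset` families -/

/-- The `Finset` version of a family of events: `s ∈ toFinsetFam U j ↔ ↑s ∈ U j`. [this work] -/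
def toFinsetFam {k : ℕ} (U : Fin k → Set (Set ι)) : Fin k → Finset (Finset ι) := fun j => univ.filter fun s => (↑s : Set ι) ∈ U j

/-- Membership in `toFinsetFam`. [this work] -/
theorem mem_toFinsetFam {k : ℕ} {U : Fin k → Set (Set ι)} {j : Fin k} {s : Finset ι} : s ∈ toFinsetFam U j ↔ (↑s : Set ι) ∈ U j := by
  simp [toFinsetFam]

/-- `1_{toFinsetFam U j}(s) = 1_{U j}(↑s)`. [this work] -/
theorem setInd_toFinsetFam {k : ℕ} (U : Fin k → Set (Set ι)) (j : Fin k) (s : Finset ι) :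
    setInd (toFinsetFam U j) s = ind (U j) (↑s : Set ι) := by
  rw [setInd_apply]
  by_cases h : (↑s : Set ι) ∈ U j
  · rw [if_pos (mem_toFinsetFam.2 h), ind_of_mem h]
  · rw [if_neg (fun h' => h (mem_toFinsetFam.1 h')), ind_of_not_mem h]

/-- The product weight on `Set ι` restricted to coerced finsets is the sparse weight `spw x 1`. [this work] -/
theorem weight_coe_eq_spw (x : ι → ℝ) (s : Finset ι) : weight x (↑s : Set ι) = spw x 1 s := by
  rw [weight, spw, ← prod_sdiff (subset_univ s), mul_comm]
  congr 1
  · exact prod_congr rfl fun e he => by rw [if_pos (Finset.mem_coe.2 he), one_mul]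
  · exact prod_congr rfl fun e he => by rw [if_neg (fun h => (mem_sdiff.1 he).2 (Finset.mem_coe.1 h)), one_mul]

/-- **Transport of `E_k`**: `E_k(spw x 1; 1_{toFinsetFam U}) = E_k(weight x; 1_U)` (relabelling `Finset ι ≃ Set ι`). [this work] -/
theorem sahiE_spw_toFinsetFam (x : ι → ℝ) {k : ℕ} (U : Fin k → Set (Set ι)) :
    sahiE (spw x 1) k (fun j => setInd (toFinsetFam U j)) = sahiE (weight x) k (fun j => ind (U j)) := by
  let e : Finset ι ≃ Set ι := Fintype.finsetEquivSet
  have hpush : pushWeight (weight x) e.symm = spw x 1 := by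
    funext s
    rw [pushWeight_equiv, Equiv.symm_symm]
    exact weight_coe_eq_spw x s
  have h := sahiE_pushWeight (weight x) e.symm k (fun j => setInd (toFinsetFam U j))
  rw [hpush] at h
  rw [h]
  congr 1
  funext j S
  show setInd (toFinsetFam U j) (e.symm S) = ind (U j) S
  rw [setInd_toFinsetFam]
  have : (↑(e.symm S) : Set ι) = S := e.apply_symm_apply S
  rw [this]

/-! ### Vanishing on the open cube is vanishing everywhere -/

/-- **If `E_k(μ_p; 1_U) = 0` for every interior `p` then `E_k(weight x; 1_U) = 0` for every real parameter vector `x`** (`E_k` is a polynomial of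
degree `≤ k` in each parameter; Nullstellensatz on a grid of `k + 1` interior points per axis). [this work] -/
theorem forall_sahiE_weight_eq_zero_of_interior {k : ℕ} (F : Fin k → Set ι → ℝ)
    (hE : ∀ p : ι → unitInterval, (∀ e, (p e : ℝ) ∈ Set.Ioo (0 : ℝ) 1) → sahiE (bernoulliWeight p) k F = 0) (x : ι → ℝ) :
    sahiE (weight x) k F = 0 := by
  have hpoly : sahiEPoly k F = 0 := by
    refine eq_zero_of_eval_zero_at_prod_finset _ (fun _ => gridPts k)
      (fun e => (degreeOf_sahiEPoly_le e k F).trans_lt (by rw [card_gridPts]; omega)) fun y hy => ?_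
    have hy01 : ∀ e, y e ∈ Set.Ioo (0 : ℝ) 1 := fun e => mem_Ioo_of_mem_gridPts (hy e)
    rw [eval_sahiEPoly]
    exact hE (fun e => ⟨y e, (hy01 e).1.le, (hy01 e).2.le⟩) hy01
  have h := eval_sahiEPoly x k F
  rw [hpoly, map_zero] at h
  exact h.symm

/-! ### Transfer of the support flag -/

/-- Every `S : Set ι` is a coerced finset. [folklore] -/
theorem exists_coe_eq (S : Set ι) : ∃ s : Finset ι, (↑s : Set ι) = S := ⟨(Set.toFinite S).toFinset, Set.Finite.coe_toFinset _⟩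

/-- `FDetBy` (finsets) gives `DeterminedBy` (sets). [this work] -/
theorem determinedBy_of_fDetBy {V : Finset (Finset ι)} {U : Set (Set ι)} (hVU : ∀ s : Finset ι, s ∈ V ↔ (↑s : Set ι) ∈ U) {A : Finset ι}
    (h : FDetBy V A) : DeterminedBy U (↑A : Set ι) := by
  rw [determinedBy_iff]
  intro ω ω' hωω'
  obtain ⟨s, rfl⟩ := exists_coe_eq ω
  obtain ⟨s', rfl⟩ := exists_coe_eq ω'
  have hss' : s ∩ A = s' ∩ A := by
    apply Finset.coe_injective
    rw [Finset.coe_inter, Finset.coe_inter]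
    exact hωω'
  rw [← hVU, ← hVU, h s, h s', hss']

/-- **The `Finset` support flag transfers to the tree's `SuppZeroFlag`.** [this work] -/
theorem suppZeroFlag_of_finSuppZeroFlag : ∀ (k : ℕ) (V : Fin k → Finset (Finset ι)) (U : Fin k → Set (Set ι)),
    (∀ j (s : Finset ι), s ∈ V j ↔ (↑s : Set ι) ∈ U j) → FinSuppZeroFlag k V → SuppZeroFlag k U
  | 0, _, _, _, _ => trivial
  | 1, V, U, hVU, h => by
    show U 0 = ∅
    have h' : V 0 = ∅ := h
    refine Set.eq_empty_of_forall_notMem fun S hS => ?_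
    obtain ⟨s, rfl⟩ := exists_coe_eq S
    have := (hVU 0 s).2 hS
    rw [h'] at this
    exact absurd this (by simp)
  | 2, V, U, hVU, ⟨A, B, hAB, hA, hB⟩ =>
    ⟨A, B, hAB, determinedBy_of_fDetBy (hVU 0) hA, determinedBy_of_fDetBy (hVU 1) hB⟩
  | k + 3, V, U, hVU, ⟨i, hdel, hmod⟩ => by
    refine ⟨i, suppZeroFlag_of_finSuppZeroFlag (k + 2) _ _ (fun j s => hVU _ s) hdel, fun l => ?_⟩
    refine suppZeroFlag_of_finSuppZeroFlag (k + 2) _ _ (fun j s => ?_) (hmod l)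
    by_cases hj : j = l
    · subst hj
      rw [update_self, update_self, mem_inter, Set.mem_inter_iff, hVU, hVU]
    · rw [update_of_ne hj, update_of_ne hj, hVU]

/-! ### (EQI-k) on the principal-cap class -/

/-- **`MasterFamilyIdentEqIff`, `⇒` direction, ON THE PRINCIPAL-CAP CLASS, EVERY ORDER.**  For `n + 1` increasing events `U_j ⊆ 2^ι` (finite `ι`),
none of them sure (`∅ ∉ U_j`), whose common part is principal (`⋂ U_j = {S : ↑c ⊆ S}`): if `E_{n+1}(μ_p; 1_{U_0},…,1_{U_n}) = 0` for every `p` in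
the open cube then `U ∈ Z_{n+1}` (`SuppZeroFlag`). [this work] -/
theorem suppZeroFlag_of_principalCap {n : ℕ} (U : Fin (n + 1) → Set (Set ι)) (hU : ∀ j, IsUpperSet (U j)) (h0 : ∀ j, (∅ : Set ι) ∉ U j)
    (c : Finset ι) (hpc : ∀ S : Set ι, (∀ j, S ∈ U j) ↔ (↑c : Set ι) ⊆ S)
    (hE : ∀ p : ι → unitInterval, (∀ e, (p e : ℝ) ∈ Set.Ioo (0 : ℝ) 1) → sahiE (bernoulliWeight p) (n + 1) (fun j => ind (U j)) = 0) :
    SuppZeroFlag (n + 1) U := by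
  set V := toFinsetFam U with hVdef
  have hVU : ∀ j (s : Finset ι), s ∈ V j ↔ (↑s : Set ι) ∈ U j := fun j s => mem_toFinsetFam
  have hVup : ∀ j a a', a ∈ V j → a ⊆ a' → a' ∈ V j :=
    fun j a a' ha haa' => (hVU j a').2 (hU j (Finset.coe_subset.2 haa') ((hVU j a).1 ha))
  have hV0 : ∀ j, ∅ ∉ V j := fun j h => h0 j (by rw [← Finset.coe_empty]; exact (hVU j ∅).1 h)
  have hVpc : IsPrincipalCap V c := by
    intro a
    rw [← Finset.coe_subset, ← hpc]
    exact forall_congr' fun j => hVU j a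
  have hEV : ∀ (w : ι → ℝ) (p : ℝ), sahiE (spw w p) (n + 1) (fun j => setInd (V j)) = 0 := by
    intro w p
    have hwp : spw w p = spw (fun e => p * w e) 1 := by
      funext ω; simp only [spw, one_mul]
    rw [hwp, hVdef, sahiE_spw_toFinsetFam]
    exact forall_sahiE_weight_eq_zero_of_interior _ hE _
  exact suppZeroFlag_of_finSuppZeroFlag (n + 1) V U hVU (finSuppZeroFlag_of_forall_sahiE_eq_zero V c hVup hV0 hVpc hEV)

/-- **`MasterFamilyIdentEqIff (n+1)` RESTRICTED TO THE PRINCIPAL-CAP CLASS, every `n`**: for increasing, non-sure, principal-cap families,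
`E_{n+1}(μ_p; 1_U) = 0` for every interior `p` `⟺ U ∈ Z_{n+1}` (`⇐` is the tree's `sahiE_ind_eq_zero_of_suppZeroFlag`, valid everywhere). [this work] -/
theorem sahiE_eq_zero_iff_suppZeroFlag_of_principalCap {n : ℕ} (U : Fin (n + 1) → Set (Set ι)) (hU : ∀ j, IsUpperSet (U j))
    (h0 : ∀ j, (∅ : Set ι) ∉ U j) (c : Finset ι) (hpc : ∀ S : Set ι, (∀ j, S ∈ U j) ↔ (↑c : Set ι) ⊆ S) :
    (∀ p : ι → unitInterval, (∀ e, (p e : ℝ) ∈ Set.Ioo (0 : ℝ) 1) → sahiE (bernoulliWeight p) (n + 1) (fun j => ind (U j)) = 0) ↔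
      SuppZeroFlag (n + 1) U :=
  ⟨suppZeroFlag_of_principalCap U hU h0 c hpc, fun h p _ => sahiE_ind_eq_zero_of_suppZeroFlag p h⟩

end SahiSparseEnd

end Summit.CriticalPhenomena.PercolationContinuityZ3.Theorems
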